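import Literature.Barriers.NavierStokesRegularity.HypodissipativeLerayNonuniquenessDeRosaProofs
import Literature.Analysis.FluidPDE.DeRosaPerturbationHolds
import Literature.Analysis.FluidPDE.DeRosaGluingPotential
import Literature.Analysis.FluidPDE.OnsagerBDSVCommutatorHolds
import Literature.Analysis.FluidPDE.FracNSContinuation
import Literature.Analysis.FluidPDE.FracNSApriori
import Literature.Analysis.FluidPDE.TorusHeatForcedIcc
import HarnessLib

/-!
# De Rosa 2019, Thm. 1.2 — the barrier `HypodissipativeLerayNonuniqueness` from short-time
  existence of smooth solutions of the fractional Navier–Stokes equations alone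

Sixth sibling proof file (theorems only: no definitions, no named facts) of the barrier entry
`Literature/Barriers/NavierStokesRegularity/HypodissipativeLerayNonuniqueness` (D-0021), whose
catalogue entry `HypodissipativeLerayNonuniqueness` is by definition De Rosa's Thm. 1.2
(`DeRosa2019_thm12`: for `γ < 1/3` some divergence-free `v̄ ∈ L²(𝕋³)` is the datum of
infinitely many Leray solutions of `∂ₜv + div(v ⊗ v) + ∇p + (-Δ)^γ v = 0`).

State of the discharge in the tree (all of the following are PROVED): the assembly of Thm. 1.2
from Thm. 2.1 and Leray's existence theorem (`HypodissipativeLerayNonuniquenessDeRosaProofs`),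
Thm. 2.1 from Prop. 4.1 run from zero and the time-regularity step (`DeRosaSchemeProofs`,
`DeRosaTimeRegularityProofs`), Prop. 4.1 from its three stages (`DeRosaStagesProofs`) with the
mollification stage (`DeRosaMollificationProofs`) and the perturbation stage
(`Literature.Analysis.FluidPDE.DeRosa.perturbationStage_holds`, `DeRosaPerturbationHolds`)
discharged, and the gluing stage reduced to two inputs
(`Literature.Analysis.FluidPDE.DeRosa.gluingStage_of_localExistence₀_of_commutatorCZBound`,
`DeRosaGluingPotential`): the commutator estimate of Buckmaster–De Lellis–Székelyhidi–Vicol,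
App. D Prop. D.1 — discharged, `Literature.Analysis.FluidPDE.BDSV.commutatorCZBound_holds`
(`OnsagerBDSVCommutatorHolds`) — and the **existence clause of the local theory of the
fractional Navier–Stokes equations in Hölder spaces** (De Rosa 2019, §3.2, Prop. 3.5: "For any
`ν > 0` and any `0 < α < 1` there exists a constant `c = c(α) > 0` with the following property.
Given any initial data `u₀ ∈ C^∞`, and `T ≤ c‖u₀‖_{1+α}⁻¹`, there exists a unique solution
`v : ℝ³ × [0,T] → ℝ³` of (3.8)").

De Rosa proves Prop. 3.5 from the `H^m` energy method (Thm. 3.4: "For any `m ≥ 3` there exists a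
constant `c_m = c(m)` such that … Given any initial condition `u₀ ∈ V^m` and
`T_m := c_m‖u₀‖_V⁻¹` there exists a unique solution `v ∈ C([0,T_m], V^m) ∩ C¹([0,T_m], V^{m-2})`
… For a proof of Theorem 3.4 we refer to [MaBe2002] (Theorem 3.4 in Chapter 3) … The proof uses
the so called "energy method" and it can be easily adapted to any power `γ` of the Laplacian")
by the classical continuation argument ("We first show that all solutions given by Theorem 3.4
exist in the interval `[0,T]`, for any `T ≲ ‖u₀‖_{1+α}⁻¹`": the a priori bound (3.9)
`‖v‖_{N+α} ≲ ‖u₀‖_{N+α}` on `[0, c‖u₀‖_{1+α}⁻¹]` and restarting). This file PROVES that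
continuation argument in the vocabulary of the tree, so that the catalogue entry rests on the
short-time existence statement alone:

* `isFracNSReynoldsOn_subMean` — normalising the pressure of a smooth solution to zero mean
  (the mean `t ↦ ∫ p(t)` is smooth in time, `Torus.IsSmoothSpaceTimeOn.integral_slice`; the
  gradient is unchanged);
* `fracNS_localExistence_of_shortTime` — **Prop. 3.5 (existence clause) from short-time
  existence**: if, for every `γ ∈ (0,1)`, `ν > 0` and `M > 0`, smooth divergence-free data with
  `‖u₀‖_{C^{N₀,r₀}} ≤ M` (any fixed order `N₀` and exponent `r₀ ≤ 1`) launch smooth solutions of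
  `∂ₜv + (v·∇)v + ∇p + ν(-Δ)^γ v = 0`, `div v = 0` on a time interval `[0, h]`, `h = h(γ, ν, M) > 0`,
  then for every `α ∈ (0,1)` there is `c = c(α, N₀) > 0` such that smooth divergence-free data
  with `‖u₀‖_{1+α} ≤ K` launch smooth solutions on `[0, T']` whenever `T'K ≤ c`, for every `ν > 0`
  and `γ ∈ (0,1)` — exactly the hypothesis `hloc₀` of
  `DeRosa.gluingStage_of_localExistence₀_of_commutatorCZBound`. Proof: the a priori estimate
  `Literature.Analysis.FluidPDE.DeRosa.fracNSApriori` (De Rosa (3.9), proved in the tree, uniform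
  in `ν ≥ 0`, `γ ∈ (0,1)`) at the levels `1, …, N₀ + 1` in its dimensionless form (data
  `‖u₀‖_{N,α} ≤ UΛ^{N-1}` with `U = c/T' ≥ K` and `Λ` absorbing the finitely many higher norms of
  the smooth datum) bounds `‖v(t)‖_{C^{N₀,r₀}} ≤ 3‖v(t)‖_{N₀+1+α} ≤ M := 3CUΛ^{N₀}` along every
  solution through `u₀` on `[0, b] ⊆ [0, T']`; the short-time statement at this `M` and the
  forward continuation `Literature.Analysis.FluidPDE.Torus.IsFracNSReynoldsOn.extend_forward`
  (`FracNSContinuation`: restart, identify on the overlap by forward uniqueness, glue) reach `T'`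
  in finitely many steps of length `h/2`;
* `gluingStage_of_fracNSShortTime` — De Rosa's gluing stage (§5.2) from the short-time
  statement (with `BDSV.commutatorCZBound_holds` and `DeRosa.potentialBounds_of_exact`);
* `hypodissipativeLerayNonuniqueness_of_fracNSShortTime` — **the catalogue entry from the
  short-time statement alone** (with `DeRosa.perturbationStage_holds`), together with
  `DeRosa2019_thm12_of_fracNSShortTime`, `DeRosa2019_thm21_of_fracNSShortTime`,
  `ColomboDeLellisDeRosa2018_thm12_of_fracNSShortTime`, and the specialisation
  `hypodissipativeLerayNonuniqueness_of_fracNSShortTime_four` to the form of the tree's Euler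
  twin `Literature.Analysis.FluidPDE.Torus.eulerSmoothShortTime` (datum bound `‖u₀‖_{C⁴} ≤ M`,
  life span `c/M`; Majda–Bertozzi 2002, Thm. 3.4 with `m = 4`).

* `hypodissipativeLerayNonuniqueness_of_shortTime` — the catalogue entry from the short-time
  statement in the exact shape `hshort` consumed by the tree's
  `Literature.Analysis.FluidPDE.DeRosa.gluingStage_of_shortTime` (`FracNSLocalExistenceReduction`:
  datum class `‖u₀‖_{4+α} ≤ M` for the same `α`, zero-mean pressures), obtained from the generic
  reduction at `N₀ = 4`, `r₀ = 1/2` (the zero-mean clause is not needed); with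
  `DeRosa2019_thm12_of_shortTime`, `DeRosa2019_thm21_of_shortTime`,
  `ColomboDeLellisDeRosa2018_thm12_of_shortTime`.

Relation to `FracNSLocalExistenceReduction` (landed while this file was written): its
`DeRosa.localExistence₀_of_shortTime` is the same continuation argument for the datum class
`‖u₀‖_{4+α} ≤ M` with zero-mean pressures; `fracNS_localExistence_of_shortTime` below allows any
fixed order/exponent `(N₀, r₀)` in the datum bound, a threshold `h` independent of `α`, and no
normalisation of the pressure (supplied here by `isFracNSReynoldsOn_subMean`), so that either form
of the forthcoming short-time theorem closes the entry in one line.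

The short-time statement is kept as a HYPOTHESIS of these theorems (no named fact is introduced);
its proof by the Fourier–Galerkin energy method for the damped Galerkin systems (damping symbol
`σ = ν(2π|k|)^{2γ}`) is the programme `Literature/Analysis/FluidPDE/GalerkinSmooth*` of the tree.

## References

* L. De Rosa, *Infinitely many Leray–Hopf solutions for the fractional Navier–Stokes equations*,
  Comm. PDE 44 (2019), 335–365; arXiv:1801.10235, §1 Thm. 1.2, §3.2 Thm. 3.4 and Prop. 3.5 with
  (3.9) and the first paragraph of its proof (p. 7 of the arXiv text), §5.2. [`Derosa2018`]
* A. J. Majda, A. L. Bertozzi, *Vorticity and Incompressible Flow*, CUP 2002, §3.2 Thm. 3.4,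
  Thm. 3.5, Cor. 3.2 (continuation). [`MajdaBertozziCUP2002`]
-/

noncomputable section

open MeasureTheory Set Filter Topology Function
open scoped ENNReal NNReal

namespace Literature.Barriers.NavierStokesRegularity

open Literature.Analysis Literature.Analysis.FluidPDE

/-! ## Normalising the pressure to zero mean -/

/-- **Zero-mean normalisation of the pressure.** If `(v, p, R)` is a smooth solution of the
fractional Navier–Stokes–Reynolds system on `[a, b] × 𝕋³` (`a < b`), then so is
`(v, p - ∫ p(t), R)`, and the new pressure has zero mean at every time: the spatial mean of a
jointly smooth field is smooth in time (`Torus.IsSmoothSpaceTimeOn.integral_slice`) and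
`∇(p(t) - c) = ∇p(t)`. (De Rosa: "`p` can be recovered uniquely … if we impose that `∫ p dx = 0`",
§1 p. 3.) [folklore] -/
theorem isFracNSReynoldsOn_subMean {a b θ ν : ℝ} (hab : a < b) {v : ℝ → UnitAddTorus (Fin 3) → EuclideanSpace ℝ (Fin 3)}
    {p : ℝ → UnitAddTorus (Fin 3) → ℝ} {R : ℝ → UnitAddTorus (Fin 3) → Fin 3 → EuclideanSpace ℝ (Fin 3)}
    (h : Torus.IsFracNSReynoldsOn (Icc a b) θ ν v p R) :
    Torus.IsFracNSReynoldsOn (Icc a b) θ ν v (fun t x => p t x - ∫ y, p t y) R ∧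
      ∀ t ∈ Icc a b, FunctionSpaces.Torus.HasZeroMean (fun x => p t x - ∫ y, p t y) := by
  refine ⟨⟨h.smooth_velocity, h.smooth_pressure.sub (h.smooth_pressure.integral_slice hab),
    h.smooth_stress, fun t ht x => ?_, h.divFree, h.symm⟩, fun t ht => ?_⟩
  · have hg : FunctionSpaces.Torus.gradient (fun y => p t y - ∫ y, p t y) x =
        FunctionSpaces.Torus.gradient (p t) x := by
      unfold FunctionSpaces.Torus.gradient _root_.gradient
      rw [show FunctionSpaces.Torus.liftAt (fun y => p t y - ∫ y, p t y) x =
          fun w => FunctionSpaces.Torus.liftAt (p t) x w - ∫ y, p t y from rfl, fderiv_sub_const]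
    rw [hg]
    exact h.momentum t ht x
  · have hint : Integrable (p t) volume :=
      ((h.smooth_pressure.isSmooth_slice ht).continuous).integrable_unitAddTorus
    unfold FunctionSpaces.Torus.HasZeroMean
    rw [integral_sub hint (integrable_const _), integral_const]
    simp

/-! ## Local existence with life span `c‖u₀‖_{1+α}⁻¹` from short-time existence (De Rosa, Prop. 3.5) -/

/-- **De Rosa 2019, Prop. 3.5 (existence clause) from short-time existence of smooth solutions**
("We first show that all solutions given by Theorem 3.4 exist in the interval `[0,T]`, for any
`T ≲ ‖u₀‖_{1+α}⁻¹`", §3.2 p. 7). Hypothesis: for every `γ ∈ (0,1)`, `ν > 0` and `M > 0` there is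
`h > 0` such that every smooth divergence-free `u₀ : 𝕋³ → ℝ³` with `‖u₀‖_{C^{N₀,r₀}} ≤ M`
(`Torus.eContDiffHolderNorm N₀ r₀`, a fixed order `N₀` and exponent `r₀ ≤ 1`) is the initial value
of a smooth solution `(v, p)` of `∂ₜv + (v·∇)v + ∇p + ν(-Δ)^γ v = 0`, `div v = 0` on `[0, h] × 𝕋³`
(a fractional Navier–Stokes–Reynolds triple with zero stress). Conclusion: for every `α ∈ (0,1)`
and `γ ∈ (0,1)` there is `c > 0` such that for every `ν > 0`, every smooth divergence-free `u₀`,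
`K ≥ 0` with `‖u₀‖_{1+α} ≤ K` and every `T' > 0` with `T'K ≤ c` there is a smooth solution on
`[0, T'] × 𝕋³` with `v(0) = u₀`. Proof: `c = c(α, N₀ + 1)` is the life-span constant of the a
priori estimate `DeRosa.fracNSApriori` ((3.9), levels `1, …, N₀ + 1`); with `U = c/T' ≥ K` and
`Λ = 1 + ∑_{N ≤ N₀+1} ‖u₀‖_{N,α}/U` the datum satisfies `‖u₀‖_{N,α} ≤ UΛ^{N-1}`, so every solution
through `u₀` on `[0, b] ⊆ [0, T']` obeys `‖v(t)‖_{C^{N₀,r₀}} ≤ 3‖v(t)‖_{N₀+1,α} ≤ 3CUΛ^{N₀} =: M`;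
the short-time statement at this `M` (pressures normalised to zero mean,
`isFracNSReynoldsOn_subMean`) feeds the forward continuation
`Torus.IsFracNSReynoldsOn.extend_forward`, which reaches `T'` from `[0, min h T']` in
`⌈2T'/h⌉` steps. [cite: Derosa2018, §3.2 Prop. 3.5 and the first paragraph of its proof; Thm. 3.4] -/
theorem fracNS_localExistence_of_shortTime {N₀ : ℕ} {r₀ : ℝ≥0} (hr₀ : r₀ ≤ 1)
    (hST : ∀ γ : ℝ, 0 < γ → γ < 1 → ∀ ν : ℝ, 0 < ν → ∀ M : ℝ, 0 < M → ∃ h : ℝ, 0 < h ∧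
      ∀ u₀ : UnitAddTorus (Fin 3) → EuclideanSpace ℝ (Fin 3), FunctionSpaces.Torus.IsSmooth u₀ → FunctionSpaces.Torus.IsDivFree u₀ →
        FunctionSpaces.Torus.eContDiffHolderNorm N₀ r₀ u₀ ≤ ENNReal.ofReal M →
        ∃ (v : ℝ → UnitAddTorus (Fin 3) → EuclideanSpace ℝ (Fin 3)) (p : ℝ → UnitAddTorus (Fin 3) → ℝ),
          Torus.IsFracNSReynoldsOn (Icc 0 h) γ ν v p (fun _ _ _ => 0) ∧ v 0 = u₀) :
    ∀ α : ℝ, 0 < α → α < 1 → ∀ γ : ℝ, 0 < γ → γ < 1 → ∃ c : ℝ, 0 < c ∧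
      ∀ ν : ℝ, 0 < ν → ∀ u₀ : UnitAddTorus (Fin 3) → EuclideanSpace ℝ (Fin 3), FunctionSpaces.Torus.IsSmooth u₀ →
        FunctionSpaces.Torus.IsDivFree u₀ → ∀ K : ℝ, 0 ≤ K →
          FunctionSpaces.Torus.eContDiffHolderNorm 1 (Real.toNNReal α) u₀ ≤ ENNReal.ofReal K →
          ∀ T' : ℝ, 0 < T' → T' * K ≤ c →
            ∃ (v : ℝ → UnitAddTorus (Fin 3) → EuclideanSpace ℝ (Fin 3)) (p : ℝ → UnitAddTorus (Fin 3) → ℝ),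
              Torus.IsFracNSReynoldsOn (Icc 0 T') γ ν v p (fun _ _ _ => 0) ∧ v 0 = u₀ := by
  intro α hα hα1 γ hγ hγ1
  set αn : ℝ≥0 := Real.toNNReal α with hαn_def
  have hαn : 0 < αn := Real.toNNReal_pos.2 hα
  have hαn1 : αn < 1 := Real.toNNReal_lt_one.2 hα1
  obtain ⟨c, hc, C, hC, hAP⟩ := DeRosa.fracNSApriori hαn hαn1 (N₀ + 1)
  refine ⟨c, hc, fun ν hν u₀ hu₀ hdiv K hK hKu T' hT' hTK => ?_⟩
  -- dimensionless data: `U = c/T' ≥ K`, `T'U = c`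
  set U : ℝ := c / T' with hU_def
  have hU : 0 < U := div_pos hc hT'
  have hTU : T' * U = c := by rw [hU_def]; field_simp
  have hKU : K ≤ U := by
    rw [hU_def, le_div_iff₀ hT']
    linarith [mul_comm T' K]
  -- the finitely many Hölder norms of the smooth datum
  have hfin : ∀ N, FunctionSpaces.Torus.eContDiffHolderNorm N αn u₀ < ⊤ := fun N =>
    hu₀.eContDiffHolderNorm_lt_top N hαn1.le
  set B : ℕ → ℝ := fun N => (FunctionSpaces.Torus.eContDiffHolderNorm N αn u₀).toReal with hB_def
  have hB : ∀ N, FunctionSpaces.Torus.eContDiffHolderNorm N αn u₀ = ENNReal.ofReal (B N) := fun N =>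
    (ENNReal.ofReal_toReal (hfin N).ne).symm
  have hB0 : ∀ N, 0 ≤ B N := fun N => ENNReal.toReal_nonneg
  set Λ : ℝ := 1 + (∑ N ∈ Finset.range (N₀ + 2), B N) / U with hΛ_def
  have hsum0 : 0 ≤ ∑ N ∈ Finset.range (N₀ + 2), B N := Finset.sum_nonneg fun N _ => hB0 N
  have hΛ1 : 1 ≤ Λ := le_add_of_nonneg_right (div_nonneg hsum0 hU.le)
  have hBΛ : ∀ N, N ≤ N₀ + 1 → B N ≤ U * Λ := by
    intro N hN
    have h1 : B N ≤ ∑ N ∈ Finset.range (N₀ + 2), B N :=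
      Finset.single_le_sum (fun N _ => hB0 N) (Finset.mem_range.2 (by omega))
    have h2 : U * Λ = U + ∑ N ∈ Finset.range (N₀ + 2), B N := by
      rw [hΛ_def, mul_add, mul_one, mul_div_cancel₀ _ hU.ne']
    rw [h2]
    linarith
  have hdat : ∀ N, 1 ≤ N → N ≤ N₀ + 1 →
      FunctionSpaces.Torus.eContDiffHolderNorm N αn u₀ ≤ ENNReal.ofReal (U * Λ ^ (N - 1)) := by
    intro N h1 h2
    rcases h1.eq_or_lt with h | hlt
    · subst h
      rw [Nat.sub_self, pow_zero, mul_one]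
      exact hKu.trans (ENNReal.ofReal_le_ofReal hKU)
    · rw [hB N]
      refine ENNReal.ofReal_le_ofReal ((hBΛ N h2).trans ?_)
      have hΛpow : Λ ≤ Λ ^ (N - 1) := le_self_pow₀ hΛ1 (by omega)
      exact mul_le_mul_of_nonneg_left hΛpow hU.le
  -- the a priori bound along every solution through `u₀` on `[0, b] ⊆ [0, T']`
  set M : ℝ := 3 * (C * U * Λ ^ N₀) with hM_def
  have hCUΛ : 0 < C * U * Λ ^ N₀ := by positivity
  have hM : 0 < M := by positivity
  have hM3 : (3 : ℝ≥0∞) * ENNReal.ofReal (C * U * Λ ^ N₀) = ENNReal.ofReal M := by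
    rw [hM_def, ENNReal.ofReal_mul (by norm_num : (0 : ℝ) ≤ 3), ENNReal.ofReal_ofNat]
  have hbound : ∀ (b : ℝ) (w : ℝ → UnitAddTorus (Fin 3) → EuclideanSpace ℝ (Fin 3)) (q : ℝ → UnitAddTorus (Fin 3) → ℝ), 0 < b → b ≤ T' →
      Torus.IsFracNSReynoldsOn (Icc 0 b) γ ν w q (fun _ _ _ => 0) → w 0 = u₀ →
      ∀ t ∈ Icc 0 b, FunctionSpaces.Torus.eContDiffHolderNorm N₀ r₀ (w t) ≤ ENNReal.ofReal M := by
    intro b w q hb hbT hw hw0 t ht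
    have hdat' : ∀ N, 1 ≤ N → N ≤ N₀ + 1 →
        FunctionSpaces.Torus.eContDiffHolderNorm N αn (w 0) ≤ ENNReal.ofReal (U * Λ ^ (N - 1)) := by
      rw [hw0]
      exact hdat
    have hbU : (b - 0) * U ≤ c := by
      rw [sub_zero, ← hTU]
      exact mul_le_mul_of_nonneg_right hbT hU.le
    have hap := hAP hb hν.le hγ hγ1 hw hU hΛ1 hdat' hbU t ht (N₀ + 1) (by omega) le_rfl
    rw [Nat.add_sub_cancel] at hap
    have hsm : FunctionSpaces.Torus.IsSmooth (w t) := hw.smooth_velocity.isSmooth_slice ht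
    calc FunctionSpaces.Torus.eContDiffHolderNorm N₀ r₀ (w t)
        ≤ 3 * FunctionSpaces.Torus.eContDiffHolderNorm (N₀ + 1) αn (w t) :=
          FunctionSpaces.Torus.eContDiffHolderNorm_le_three_mul_succ (hsm.isContDiff (mod_cast le_top)) hr₀ αn
      _ ≤ 3 * ENNReal.ofReal (C * U * Λ ^ N₀) := by gcongr
      _ = ENNReal.ofReal M := hM3
  -- the short-time solver for data of the class `‖·‖_{C^{N₀,r₀}} ≤ M`, pressures normalised
  obtain ⟨h, hh, hloc⟩ := hST γ hγ hγ1 ν hν M hM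
  have hloc' : ∀ v₀ : UnitAddTorus (Fin 3) → EuclideanSpace ℝ (Fin 3), FunctionSpaces.Torus.IsSmooth v₀ → FunctionSpaces.Torus.IsDivFree v₀ →
      FunctionSpaces.Torus.eContDiffHolderNorm N₀ r₀ v₀ ≤ ENNReal.ofReal M →
        ∃ (w : ℝ → UnitAddTorus (Fin 3) → EuclideanSpace ℝ (Fin 3)) (π : ℝ → UnitAddTorus (Fin 3) → ℝ),
          Torus.IsFracNSReynoldsOn (Icc 0 h) γ ν w π (fun _ _ _ => 0) ∧ w 0 = v₀ ∧
            ∀ t ∈ Icc 0 h, FunctionSpaces.Torus.HasZeroMean (π t) := by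
    intro v₀ hv₀ hdv hP
    obtain ⟨w, π, hw, hw0⟩ := hloc v₀ hv₀ hdv hP
    obtain ⟨hw', hz⟩ := isFracNSReynoldsOn_subMean hh hw
    exact ⟨w, _, hw', hw0, hz⟩
  -- the datum belongs to the class
  have hP0 : FunctionSpaces.Torus.eContDiffHolderNorm N₀ r₀ u₀ ≤ ENNReal.ofReal M := by
    have h1 := hdat (N₀ + 1) (by omega) le_rfl
    rw [Nat.add_sub_cancel] at h1
    calc FunctionSpaces.Torus.eContDiffHolderNorm N₀ r₀ u₀
        ≤ 3 * FunctionSpaces.Torus.eContDiffHolderNorm (N₀ + 1) αn u₀ :=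
          FunctionSpaces.Torus.eContDiffHolderNorm_le_three_mul_succ (hu₀.isContDiff (mod_cast le_top)) hr₀ αn
      _ ≤ 3 * ENNReal.ofReal (U * Λ ^ N₀) := by gcongr
      _ ≤ 3 * ENNReal.ofReal (C * U * Λ ^ N₀) := by
          have h0 : 0 ≤ U * Λ ^ N₀ := by positivity
          have hle : U * Λ ^ N₀ ≤ C * U * Λ ^ N₀ :=
            calc U * Λ ^ N₀ = 1 * (U * Λ ^ N₀) := (one_mul _).symm
              _ ≤ C * (U * Λ ^ N₀) := mul_le_mul_of_nonneg_right hC h0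
              _ = C * U * Λ ^ N₀ := by ring
          exact mul_le_mul' le_rfl (ENNReal.ofReal_le_ofReal hle)
      _ = ENNReal.ofReal M := hM3
  -- the first piece, on `[0, min h T']`
  obtain ⟨w₀, π₀, hw₀, hw₀0, hz₀⟩ := hloc' u₀ hu₀ hdiv hP0
  set b₀ : ℝ := min h T' with hb₀_def
  have hb₀ : 0 < b₀ := lt_min hh hT'
  have hb₀T : b₀ ≤ T' := min_le_right _ _
  have hb₀h : b₀ ≤ h := min_le_left _ _
  have hw₀' : Torus.IsFracNSReynoldsOn (Icc 0 b₀) γ ν w₀ π₀ (fun _ _ _ => 0) :=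
    hw₀.mono (Icc_subset_Icc le_rfl hb₀h) (uniqueDiffOn_Icc hb₀)
  have hz₀' : ∀ t ∈ Icc 0 b₀, FunctionSpaces.Torus.HasZeroMean (π₀ t) := fun t ht =>
    hz₀ t ⟨ht.1, ht.2.trans hb₀h⟩
  -- finitely many continuation steps reach `T'`
  obtain ⟨n, hn⟩ : ∃ n : ℕ, T' ≤ b₀ + n * (h / 2) := by
    obtain ⟨n, hn⟩ := exists_nat_ge (T' / (h / 2))
    refine ⟨n, ?_⟩
    have h1 : T' ≤ n * (h / 2) := by rwa [div_le_iff₀ (half_pos hh)] at hn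
    linarith [hb₀.le]
  obtain ⟨v, p, hv, hv0, -⟩ := Torus.IsFracNSReynoldsOn.extend_forward
    (P := fun v₀ => FunctionSpaces.Torus.eContDiffHolderNorm N₀ r₀ v₀ ≤ ENNReal.ofReal M)
    hloc' (fun b w q hb hbT hw hw0 => hbound b w q hb hbT hw hw0) hγ.le hν.le hh hb₀ hb₀T
    hw₀' hw₀0 hz₀' n
  have hmin : min (b₀ + n * (h / 2)) T' = T' := min_eq_right hn
  rw [hmin] at hv
  exact ⟨v, p, hv, hv0⟩

/-! ## De Rosa's gluing stage and the barrier from the short-time statement -/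

/-- **De Rosa's gluing stage from short-time existence of smooth solutions** (§5.2: Cor. 5.2,
Props. 5.3–5.5): `DeRosa.gluingStage` follows from the short-time statement (any fixed order `N₀`
and exponent `r₀ ≤ 1` in the datum bound) through `fracNS_localExistence_of_shortTime`, the
commutator estimate `BDSV.commutatorCZBound_holds` and
`DeRosa.gluingStage_of_localExistence₀_of_commutatorCZBound`.
[cite: Derosa2018, §3.2 Prop. 3.5; §5.2] -/
theorem gluingStage_of_fracNSShortTime {N₀ : ℕ} {r₀ : ℝ≥0} (hr₀ : r₀ ≤ 1)
    (hST : ∀ γ : ℝ, 0 < γ → γ < 1 → ∀ ν : ℝ, 0 < ν → ∀ M : ℝ, 0 < M → ∃ h : ℝ, 0 < h ∧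
      ∀ u₀ : UnitAddTorus (Fin 3) → EuclideanSpace ℝ (Fin 3), FunctionSpaces.Torus.IsSmooth u₀ → FunctionSpaces.Torus.IsDivFree u₀ →
        FunctionSpaces.Torus.eContDiffHolderNorm N₀ r₀ u₀ ≤ ENNReal.ofReal M →
        ∃ (v : ℝ → UnitAddTorus (Fin 3) → EuclideanSpace ℝ (Fin 3)) (p : ℝ → UnitAddTorus (Fin 3) → ℝ),
          Torus.IsFracNSReynoldsOn (Icc 0 h) γ ν v p (fun _ _ _ => 0) ∧ v 0 = u₀) :
    DeRosa.gluingStage :=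
  DeRosa.gluingStage_of_localExistence₀_of_commutatorCZBound
    (fracNS_localExistence_of_shortTime hr₀ hST) BDSV.commutatorCZBound_holds

/-- **The barrier `HypodissipativeLerayNonuniqueness` (De Rosa 2019, Thm. 1.2) from short-time
existence of smooth solutions of the fractional Navier–Stokes equations alone.** With the
assembly §2, Thm. 1.1, Cor. 7.2, the time-regularity step §4.2, the mollification and
perturbation stages of Prop. 4.1 and the commutator estimate all proved in the tree, and the
continuation argument of Prop. 3.5 proved above, the catalogue entry follows from the `H^m`
energy-method statement (De Rosa Thm. 3.4 = Majda–Bertozzi Thm. 3.4 "adapted to any power `γ` of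
the Laplacian") in the weak form: for `γ ∈ (0,1)`, `ν > 0`, `M > 0` some `h > 0` such that smooth
divergence-free data with `‖u₀‖_{C^{N₀,r₀}} ≤ M` launch smooth solutions on `[0, h] × 𝕋³`.
[cite: Derosa2018, §1 Thm. 1.2; §2; §3.2 Thm. 3.4, Prop. 3.5; §4.2; §5] -/
theorem hypodissipativeLerayNonuniqueness_of_fracNSShortTime {N₀ : ℕ} {r₀ : ℝ≥0} (hr₀ : r₀ ≤ 1)
    (hST : ∀ γ : ℝ, 0 < γ → γ < 1 → ∀ ν : ℝ, 0 < ν → ∀ M : ℝ, 0 < M → ∃ h : ℝ, 0 < h ∧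
      ∀ u₀ : UnitAddTorus (Fin 3) → EuclideanSpace ℝ (Fin 3), FunctionSpaces.Torus.IsSmooth u₀ → FunctionSpaces.Torus.IsDivFree u₀ →
        FunctionSpaces.Torus.eContDiffHolderNorm N₀ r₀ u₀ ≤ ENNReal.ofReal M →
        ∃ (v : ℝ → UnitAddTorus (Fin 3) → EuclideanSpace ℝ (Fin 3)) (p : ℝ → UnitAddTorus (Fin 3) → ℝ),
          Torus.IsFracNSReynoldsOn (Icc 0 h) γ ν v p (fun _ _ _ => 0) ∧ v 0 = u₀) :
    HypodissipativeLerayNonuniqueness :=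
  hypodissipativeLerayNonuniqueness_of_gluing_of_perturbation (gluingStage_of_fracNSShortTime hr₀ hST)
    DeRosa.perturbationStage_holds

/-- De Rosa 2019, Thm. 1.2 from the short-time statement. [cite: Derosa2018, §1 Thm. 1.2, §3.2] -/
theorem DeRosa2019_thm12_of_fracNSShortTime {N₀ : ℕ} {r₀ : ℝ≥0} (hr₀ : r₀ ≤ 1)
    (hST : ∀ γ : ℝ, 0 < γ → γ < 1 → ∀ ν : ℝ, 0 < ν → ∀ M : ℝ, 0 < M → ∃ h : ℝ, 0 < h ∧
      ∀ u₀ : UnitAddTorus (Fin 3) → EuclideanSpace ℝ (Fin 3), FunctionSpaces.Torus.IsSmooth u₀ → FunctionSpaces.Torus.IsDivFree u₀ →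
        FunctionSpaces.Torus.eContDiffHolderNorm N₀ r₀ u₀ ≤ ENNReal.ofReal M →
        ∃ (v : ℝ → UnitAddTorus (Fin 3) → EuclideanSpace ℝ (Fin 3)) (p : ℝ → UnitAddTorus (Fin 3) → ℝ),
          Torus.IsFracNSReynoldsOn (Icc 0 h) γ ν v p (fun _ _ _ => 0) ∧ v 0 = u₀) :
    DeRosa2019_thm12 :=
  (hypodissipativeLerayNonuniqueness_iff).1 (hypodissipativeLerayNonuniqueness_of_fracNSShortTime hr₀ hST)

/-- De Rosa 2019, Thm. 2.1 (prescribed-energy `C^β` solutions) from the short-time statement.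
[cite: Derosa2018, §2 Thm. 2.1, §4.2, §5] -/
theorem DeRosa2019_thm21_of_fracNSShortTime {N₀ : ℕ} {r₀ : ℝ≥0} (hr₀ : r₀ ≤ 1)
    (hST : ∀ γ : ℝ, 0 < γ → γ < 1 → ∀ ν : ℝ, 0 < ν → ∀ M : ℝ, 0 < M → ∃ h : ℝ, 0 < h ∧
      ∀ u₀ : UnitAddTorus (Fin 3) → EuclideanSpace ℝ (Fin 3), FunctionSpaces.Torus.IsSmooth u₀ → FunctionSpaces.Torus.IsDivFree u₀ →
        FunctionSpaces.Torus.eContDiffHolderNorm N₀ r₀ u₀ ≤ ENNReal.ofReal M →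
        ∃ (v : ℝ → UnitAddTorus (Fin 3) → EuclideanSpace ℝ (Fin 3)) (p : ℝ → UnitAddTorus (Fin 3) → ℝ),
          Torus.IsFracNSReynoldsOn (Icc 0 h) γ ν v p (fun _ _ _ => 0) ∧ v 0 = u₀) :
    DeRosa2019_thm21 :=
  DeRosa2019_thm21_of_gluing_of_perturbation (gluingStage_of_fracNSShortTime hr₀ hST)
    DeRosa.perturbationStage_holds

/-- Colombo–De Lellis–De Rosa 2018, Thm. 1.2 (`α < 1/5`) from the short-time statement.
[cite: Derosa2018, §1 Thm. 1.2] [cite: ColomboDelellisDerosa2018, §1 Thm. 1.2] -/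
theorem ColomboDeLellisDeRosa2018_thm12_of_fracNSShortTime {N₀ : ℕ} {r₀ : ℝ≥0} (hr₀ : r₀ ≤ 1)
    (hST : ∀ γ : ℝ, 0 < γ → γ < 1 → ∀ ν : ℝ, 0 < ν → ∀ M : ℝ, 0 < M → ∃ h : ℝ, 0 < h ∧
      ∀ u₀ : UnitAddTorus (Fin 3) → EuclideanSpace ℝ (Fin 3), FunctionSpaces.Torus.IsSmooth u₀ → FunctionSpaces.Torus.IsDivFree u₀ →
        FunctionSpaces.Torus.eContDiffHolderNorm N₀ r₀ u₀ ≤ ENNReal.ofReal M →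
        ∃ (v : ℝ → UnitAddTorus (Fin 3) → EuclideanSpace ℝ (Fin 3)) (p : ℝ → UnitAddTorus (Fin 3) → ℝ),
          Torus.IsFracNSReynoldsOn (Icc 0 h) γ ν v p (fun _ _ _ => 0) ∧ v 0 = u₀) :
    ColomboDeLellisDeRosa2018_thm12 :=
  (DeRosa2019_thm12_of_fracNSShortTime hr₀ hST).colomboDeLellisDeRosa

/-! ## The Euler-twin form: datum bound in `C⁴`, life span `c/M` -/

/-- **The barrier from the fractional twin of `Torus.eulerSmoothShortTime`.** If for every
`γ ∈ (0,1)` and `ν > 0` there is `c > 0` such that every smooth divergence-free `u₀ : 𝕋³ → ℝ³`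
with `‖u₀‖_{C⁴(𝕋³)} ≤ M`, `M > 0` (`Torus.eContDiffHolderNorm 4 0`), is the initial value of a
smooth solution of `∂ₜv + (v·∇)v + ∇p + ν(-Δ)^γ v = 0`, `div v = 0` on `[0, c/M] × 𝕋³` (the
statement of Majda–Bertozzi 2002, Thm. 3.4 with `m = 4`, "easily adapted to any power `γ` of the
Laplacian", De Rosa §3.2), then `HypodissipativeLerayNonuniqueness` holds.
[cite: Derosa2018, §3.2 Thm. 3.4] [cite: MajdaBertozziCUP2002, Thm. 3.4] -/
theorem hypodissipativeLerayNonuniqueness_of_fracNSShortTime_four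
    (hST : ∀ γ : ℝ, 0 < γ → γ < 1 → ∀ ν : ℝ, 0 < ν → ∃ c : ℝ, 0 < c ∧
      ∀ u₀ : UnitAddTorus (Fin 3) → EuclideanSpace ℝ (Fin 3), FunctionSpaces.Torus.IsSmooth u₀ → FunctionSpaces.Torus.IsDivFree u₀ →
        ∀ M : ℝ, 0 < M → FunctionSpaces.Torus.eContDiffHolderNorm 4 0 u₀ ≤ ENNReal.ofReal M →
          ∃ (v : ℝ → UnitAddTorus (Fin 3) → EuclideanSpace ℝ (Fin 3)) (p : ℝ → UnitAddTorus (Fin 3) → ℝ),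
            Torus.IsFracNSReynoldsOn (Icc 0 (c / M)) γ ν v p (fun _ _ _ => 0) ∧ v 0 = u₀) :
    HypodissipativeLerayNonuniqueness := by
  refine hypodissipativeLerayNonuniqueness_of_fracNSShortTime (N₀ := 4) (r₀ := 0) zero_le_one
    fun γ hγ hγ1 ν hν M hM => ?_
  obtain ⟨c, hc, hsol⟩ := hST γ hγ hγ1 ν hν
  exact ⟨c / M, div_pos hc hM, fun u₀ hu₀ hdiv hM' => hsol u₀ hu₀ hdiv M hM hM'⟩


/-! ## The form `hshort` of `FracNSLocalExistenceReduction` (datum class `‖u₀‖_{4+α}`, zero-mean pressures) -/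

/-- **The barrier from the short-time statement in the shape of
`DeRosa.gluingStage_of_shortTime`.** Hypothesis (verbatim the `hshort` of
`Literature.Analysis.FluidPDE.DeRosa.gluingStage_of_shortTime`; De Rosa's Thm. 3.4, the energy
method "adapted to any power `γ` of the Laplacian"): for all `0 < α < 1`, `0 < γ < 1`, `ν > 0` and
`M > 0` there is `h > 0` such that every smooth divergence-free `u₀ : 𝕋³ → ℝ³` with
`‖u₀‖_{4+α} ≤ M` launches a smooth solution `(v, p)` of `∂ₜv + (v·∇)v + ∇p + ν(-Δ)^γ v = 0`,
`div v = 0` on `[0, h] × 𝕋³` with `v(0) = u₀` and `∫ p(t) = 0`. Conclusion: the catalogue entry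
(`hypodissipativeLerayNonuniqueness_of_fracNSShortTime` at `N₀ = 4`, `r₀ = 1/2`, the hypothesis
specialised to `α = 1/2`; the zero-mean clause is dropped). The unconditional
`HypodissipativeLerayNonuniqueness_holds` is this theorem applied to the short-time theorem.
[cite: Derosa2018, §1 Thm. 1.2; §3.2 Thm. 3.4, Prop. 3.5; §5] -/
theorem hypodissipativeLerayNonuniqueness_of_shortTime
    (hshort : ∀ α : ℝ, 0 < α → α < 1 → ∀ γ : ℝ, 0 < γ → γ < 1 → ∀ ν : ℝ, 0 < ν → ∀ M : ℝ, 0 < M →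
      ∃ h : ℝ, 0 < h ∧ ∀ u₀ : UnitAddTorus (Fin 3) → EuclideanSpace ℝ (Fin 3),
        FunctionSpaces.Torus.IsSmooth u₀ → FunctionSpaces.Torus.IsDivFree u₀ →
          FunctionSpaces.Torus.eContDiffHolderNorm 4 (Real.toNNReal α) u₀ ≤ ENNReal.ofReal M →
            ∃ (v : ℝ → UnitAddTorus (Fin 3) → EuclideanSpace ℝ (Fin 3)) (p : ℝ → UnitAddTorus (Fin 3) → ℝ),
              Torus.IsFracNSReynoldsOn (Icc 0 h) γ ν v p (fun _ _ _ => 0) ∧ v 0 = u₀ ∧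
                ∀ t ∈ Icc 0 h, FunctionSpaces.Torus.HasZeroMean (p t)) :
    HypodissipativeLerayNonuniqueness := by
  have hhalf : Real.toNNReal (1 / 2 : ℝ) ≤ 1 := by
    rw [← Real.toNNReal_one]
    exact Real.toNNReal_le_toNNReal (by norm_num)
  refine hypodissipativeLerayNonuniqueness_of_fracNSShortTime (N₀ := 4) (r₀ := Real.toNNReal (1 / 2 : ℝ))
    hhalf fun γ hγ hγ1 ν hν M hM => ?_
  obtain ⟨h, hh, hsol⟩ := hshort (1 / 2) (by norm_num) (by norm_num) γ hγ hγ1 ν hν M hM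
  refine ⟨h, hh, fun u₀ hu₀ hdiv hM' => ?_⟩
  obtain ⟨v, p, hv, hv0, -⟩ := hsol u₀ hu₀ hdiv hM'
  exact ⟨v, p, hv, hv0⟩

/-- De Rosa 2019, Thm. 1.2 from the short-time statement (shape `hshort`).
[cite: Derosa2018, §1 Thm. 1.2, §3.2 Thm. 3.4] -/
theorem DeRosa2019_thm12_of_shortTime
    (hshort : ∀ α : ℝ, 0 < α → α < 1 → ∀ γ : ℝ, 0 < γ → γ < 1 → ∀ ν : ℝ, 0 < ν → ∀ M : ℝ, 0 < M →
      ∃ h : ℝ, 0 < h ∧ ∀ u₀ : UnitAddTorus (Fin 3) → EuclideanSpace ℝ (Fin 3),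
        FunctionSpaces.Torus.IsSmooth u₀ → FunctionSpaces.Torus.IsDivFree u₀ →
          FunctionSpaces.Torus.eContDiffHolderNorm 4 (Real.toNNReal α) u₀ ≤ ENNReal.ofReal M →
            ∃ (v : ℝ → UnitAddTorus (Fin 3) → EuclideanSpace ℝ (Fin 3)) (p : ℝ → UnitAddTorus (Fin 3) → ℝ),
              Torus.IsFracNSReynoldsOn (Icc 0 h) γ ν v p (fun _ _ _ => 0) ∧ v 0 = u₀ ∧
                ∀ t ∈ Icc 0 h, FunctionSpaces.Torus.HasZeroMean (p t)) :
    DeRosa2019_thm12 :=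
  (hypodissipativeLerayNonuniqueness_iff).1 (hypodissipativeLerayNonuniqueness_of_shortTime hshort)

/-- De Rosa 2019, Thm. 2.1 (prescribed-energy `C^β` solutions) from the short-time statement
(shape `hshort`): the gluing stage by `fracNS_localExistence_of_shortTime` as above, then
`DeRosa2019_thm21_of_gluing_of_perturbation`. [cite: Derosa2018, §2 Thm. 2.1, §3.2, §4.2, §5] -/
theorem DeRosa2019_thm21_of_shortTime
    (hshort : ∀ α : ℝ, 0 < α → α < 1 → ∀ γ : ℝ, 0 < γ → γ < 1 → ∀ ν : ℝ, 0 < ν → ∀ M : ℝ, 0 < M →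
      ∃ h : ℝ, 0 < h ∧ ∀ u₀ : UnitAddTorus (Fin 3) → EuclideanSpace ℝ (Fin 3),
        FunctionSpaces.Torus.IsSmooth u₀ → FunctionSpaces.Torus.IsDivFree u₀ →
          FunctionSpaces.Torus.eContDiffHolderNorm 4 (Real.toNNReal α) u₀ ≤ ENNReal.ofReal M →
            ∃ (v : ℝ → UnitAddTorus (Fin 3) → EuclideanSpace ℝ (Fin 3)) (p : ℝ → UnitAddTorus (Fin 3) → ℝ),
              Torus.IsFracNSReynoldsOn (Icc 0 h) γ ν v p (fun _ _ _ => 0) ∧ v 0 = u₀ ∧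
                ∀ t ∈ Icc 0 h, FunctionSpaces.Torus.HasZeroMean (p t)) :
    DeRosa2019_thm21 := by
  have hhalf : Real.toNNReal (1 / 2 : ℝ) ≤ 1 := by
    rw [← Real.toNNReal_one]
    exact Real.toNNReal_le_toNNReal (by norm_num)
  refine DeRosa2019_thm21_of_fracNSShortTime (N₀ := 4) (r₀ := Real.toNNReal (1 / 2 : ℝ))
    hhalf fun γ hγ hγ1 ν hν M hM => ?_
  obtain ⟨h, hh, hsol⟩ := hshort (1 / 2) (by norm_num) (by norm_num) γ hγ hγ1 ν hν M hM
  refine ⟨h, hh, fun u₀ hu₀ hdiv hM' => ?_⟩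
  obtain ⟨v, p, hv, hv0, -⟩ := hsol u₀ hu₀ hdiv hM'
  exact ⟨v, p, hv, hv0⟩

/-- Colombo–De Lellis–De Rosa 2018, Thm. 1.2 (`α < 1/5`) from the short-time statement
(shape `hshort`). [cite: ColomboDelellisDerosa2018, §1 Thm. 1.2] [cite: Derosa2018, §1 Thm. 1.2] -/
theorem ColomboDeLellisDeRosa2018_thm12_of_shortTime
    (hshort : ∀ α : ℝ, 0 < α → α < 1 → ∀ γ : ℝ, 0 < γ → γ < 1 → ∀ ν : ℝ, 0 < ν → ∀ M : ℝ, 0 < M →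
      ∃ h : ℝ, 0 < h ∧ ∀ u₀ : UnitAddTorus (Fin 3) → EuclideanSpace ℝ (Fin 3),
        FunctionSpaces.Torus.IsSmooth u₀ → FunctionSpaces.Torus.IsDivFree u₀ →
          FunctionSpaces.Torus.eContDiffHolderNorm 4 (Real.toNNReal α) u₀ ≤ ENNReal.ofReal M →
            ∃ (v : ℝ → UnitAddTorus (Fin 3) → EuclideanSpace ℝ (Fin 3)) (p : ℝ → UnitAddTorus (Fin 3) → ℝ),
              Torus.IsFracNSReynoldsOn (Icc 0 h) γ ν v p (fun _ _ _ => 0) ∧ v 0 = u₀ ∧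
                ∀ t ∈ Icc 0 h, FunctionSpaces.Torus.HasZeroMean (p t)) :
    ColomboDeLellisDeRosa2018_thm12 :=
  (DeRosa2019_thm12_of_shortTime hshort).colomboDeLellisDeRosa

end Literature.Barriers.NavierStokesRegularity
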